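import Summits.QuantumAdvantage.QuantumAdvantage.Theorems.SosSandwichTransferPBHashedMagnitude
import Literature.Computability.QuantumComplexity.KeyedOracleFamily
import Literature.Computability.QuantumComplexity.BPPRelSubsetBQPRel
import HarnessLib

/-!
# Crux `TransferPB` (stmt-QuantumAdvantage-15238, route SosSandwich), line `birth` — the KEYED LANGUAGE of the node tests and the MEAN estimator's semantics

Obligation (Q) of the last stub `stub_pbOracleSimulation` asks for `nodeProblem F r c k ∈ PromiseBQP`
(`Theorems/SosSandwichTransferPBMachineDefs.lean`, `…EventOSMFinal.lean`). After
`Theorems/SosSandwichTransferPBHashed{Mean,Magnitude}.lean` every node quantity is an AVERAGE, over the keys of the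
explicit `k`-wise independent family `stdFamily k m key` (`Literature/…/ExplicitKWiseHashFamily.lean`), of a run statistic
of `F` at `x` relative to the oracle "hash overridden along the path `ρ`". The quantum estimator is the KEYED-ORACLE
FAMILY `KeyedRun.family` (`Literature/…/KeyedOracleFamily.lean`: Hadamards on the key wires, then `F.circ n` with every
query `u` replaced by `r ++ key ++ u`, `r` the parameter part of the instance; its kernel is the key-average of `F`'s
kernels relative to the SLICES `A⟨r ++ key⟩`, `KeyedRun.kernelProb_family_append_eq_avg`). This file fixes the ONE
oracle language `A' = keyedLang F` the estimator queries and proves that its slices are exactly the overridden hashes: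

* `kOf F n = 2T(n)`, `mOf F n = n + ancillas n` (the hash parameters: independence `2T`, width), `hashedPt F x ρ key`
  (the relevant bits of `stdFamily` overridden along `ρ`), `paramStr v pad = ⟨v, ⟨pad, ε⟩⟩` (the parameter string the
  layout writes after `x`: the instance `v` and padding, self-delimiting), `paramStr_append`;
* **`keyedLang F`** — `w ∈ A'` iff `w = ⟨⟨x, ⟨encPath ρ, t⟩⟩, ⟨pad, key ++ u⟩⟩` with `u ∈ oracleOf F x (hashedPt F x ρ key)`;
* **`prefixSlice_keyedLang`** — `A'⟨paramStr ⟨x, ⟨encPath ρ, t⟩⟩ pad ++ key⟩ = oracleOf F x (hashedPt F x ρ key)`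
  (unique readability of `boolPair`, `encPath_injective`);
* `keyedRun F nOf h` — the keyed-run parameters with `κ(L) = |key|` for `n = nOf L`; `layout F x ρ t pad = x ++ paramStr …`;
  `readRun P z s` (the measured string of `F` read through the transported wires);
* **`kernelProb_keyedRun_accept_eq_nodeMean`** — for the instance laid out as `z = layout F x ρ t pad`
  (`= x ++ paramStr ⟨x, ⟨encPath ρ, t⟩⟩ pad`) with `nOf |z| = |x|`, the probability that the transported answer wire of the keyed family (oracle `A'`) accepts is
  EXACTLY `nodeMean F x ρ = E_y[p_x|_ρ(y)]` (`nodeMean_eq_hashedAvg` + `kernelProb_prefix_true_eq_acceptProbOn`) — the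
  MEAN node test is the acceptance probability of a uniform-shape quantum circuit with a `P` oracle;
* `kernelProb_keyedRun_event_eq_avg` — the same bookkeeping for an arbitrary event on `F`'s measured string (for the
  SINGLE/BLOCK statistics of truncated runs).

What remains for (Q): `keyedLang F ∈ P` (parsing bricks + `ExplicitKWiseHashMachine.hashLang_mem_P`), the layout
`h ∈ FP` with `nOf` (e.g. `|z| = s² + n`, `CodeFP.natSqrt`), uniformity of the keyed family
(`KeyedOracleFamilyUniform.lean`, `KeyedRun.family_isUniform`), oracle removal (`OracleRemovalKernel.lean`,
`P ⊆ BQP`), the truncated-runs family for SINGLE/BLOCK, and the threshold read-out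
(`PolyBlockStatReadout.mem_PromiseBQP_of_blockStat_thresholds_pre`). All proved here; definitions are explicit; no
named fact. Sources: M. Zhandry, CRYPTO 2012, Thm. 3.1; S. Aaronson, A. Ambainis, Theory Comput. 10 (2014), proof of
Thm. 23 (p. 14); C. H. Bennett, E. Bernstein, G. Brassard, U. Vazirani, SIAM J. Comput. 26 (1997), §4.
-/

-- D-0017: single-conjunct summit ⇒ the duplicate `QuantumAdvantage.QuantumAdvantage` is mandated.
set_option linter.dupNamespace false

noncomputable section

namespace Summit.QuantumAdvantage.QuantumAdvantage.Cruxes.TransferPB.Birth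

open Finset Literature.Computability.Cryptography Literature.Computability.Complexity
  Literature.Computability.QuantumComplexity Literature.Computability.QuantumComplexity.ClassicalSimulation
  Literature.Computability.Cryptography.ExplicitKWiseHash

namespace SimTreePB

variable (F : QCircuitFamily cliffordT)

/-! ### Hash parameters and the overridden hash -/

/-- The independence parameter of the hash on inputs of length `n`: `k = 2T(n)`, `T(n)` the number of oracle gates of
`F.circ n`. [cite: Zhandry2012IBE, Thm. 3.1 (k = 2T)] -/
def kOf (n : ℕ) : ℕ := 2 * (F.circ n).oracleQueries

/-- The width parameter of the hash on inputs of length `n`: `m = n + ancillas n` (`= oracleWidth`, so every relevant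
string has length `≤ m`). [cite: AaronsonAmbainis2014, Thm. 23 (proof, p. 14: the queried prefix of the oracle)] -/
def mOf (n : ℕ) : ℕ := n + F.ancillas n

/-- `mOf` is the oracle width. -/
theorem mOf_length (x : List Bool) : mOf F x.length = oracleWidth F x := rfl

/-- **The relevant bits of the hash `stdFamily k m key` overridden along the path `ρ`** (the completion the keyed
estimator realises on the branch of `key`). [cite: Zhandry2012IBE, Thm. 3.1] [cite: AaronsonAmbainis2014, Thm. 23 (proof, p. 14)] -/
def hashedPt (x : List Bool) (ρ : List (Fin (numOracleBits F x) × Bool))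
    (key : Fin (keyPoly.eval (kOf F x.length + mOf F x.length)) → Bool) : Fin (numOracleBits F x) → Bool :=
  ρ.foldr (fun ib z => Function.update z ib.1 ib.2) (oracleBits F x (stdFamily (kOf F x.length) (mOf F x.length) key))

/-! ### The parameter string and the keyed language -/

/-- **The parameter string** written after `x` by the layout: the instance `v` and a padding `pad`, as the
self-delimiting record `⟨v, ⟨pad, ε⟩⟩`. [cite: AroraBarak2009, §0.1 (codes of tuples)] -/
def paramStr (v pad : List Bool) : List Bool := boolPair v (boolPair pad [])

/-- A query of the keyed family after the parameter string: `paramStr v pad ++ s = ⟨v, ⟨pad, s⟩⟩` (`boolPair` copies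
its second component verbatim at the end). [cite: AroraBarak2009, §0.1] -/
theorem paramStr_append (v pad s : List Bool) : paramStr v pad ++ s = boolPair v (boolPair pad s) := by
  simp [paramStr, boolPair, List.append_assoc]

/-- **The keyed language `A'` of the node tests**: `⟨⟨x, ⟨encPath ρ, t⟩⟩, ⟨pad, key ++ u⟩⟩ ∈ A'` iff `u` lies in the
oracle whose relevant bits are the hash of `key` overridden along `ρ` (`t` — the instance's tag and target — and `pad`
are ignored). [cite: Zhandry2012IBE, Thm. 3.1 (the oracle h_key)] [cite: AaronsonAmbainis2014, Thm. 23 (proof, p. 14)] -/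
def keyedLang : Language Bool :=
  ({w : List Bool | ∃ (x : List Bool) (ρ : List (Fin (numOracleBits F x) × Bool)) (t pad : List Bool)
      (key : Fin (keyPoly.eval (kOf F x.length + mOf F x.length)) → Bool) (u : List Bool),
      w = boolPair (boolPair x (boolPair (encPath F x ρ) t)) (boolPair pad (List.ofFn key ++ u)) ∧
        u ∈ oracleOf F x (hashedPt F x ρ key)} : Set (List Bool))

/-- **The slices of the keyed language are the overridden hashes**: on the branch where the parameter wires hold
`paramStr ⟨x, ⟨encPath ρ, t⟩⟩ pad` and the key wires hold `key`, the re-targeted oracle gates query exactly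
`oracleOf F x (hashedPt F x ρ key)`. [cite: Zhandry2012IBE, Thm. 3.1] [cite: NielsenChuang2010, §6.1.1] -/
theorem prefixSlice_keyedLang (x : List Bool) (ρ : List (Fin (numOracleBits F x) × Bool)) (t pad : List Bool)
    (key : Fin (keyPoly.eval (kOf F x.length + mOf F x.length)) → Bool) :
    prefixSlice (keyedLang F) (paramStr (boolPair x (boolPair (encPath F x ρ) t)) pad ++ List.ofFn key) =
      oracleOf F x (hashedPt F x ρ key) := by
  ext u
  rw [mem_prefixSlice, List.append_assoc, paramStr_append]
  constructor
  · rintro ⟨x', ρ', t', pad', key', u', hw, hu'⟩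
    obtain ⟨h1, h2⟩ := boolPair_inj.1 hw
    obtain ⟨hx, h3⟩ := boolPair_inj.1 h1
    subst hx
    obtain ⟨hρ, -⟩ := boolPair_inj.1 h3
    have hρ' : ρ = ρ' := encPath_injective F x ρ ρ' hρ
    subst hρ'
    obtain ⟨-, h4⟩ := boolPair_inj.1 h2
    have hlen : (List.ofFn key).length = (List.ofFn key').length := by simp
    obtain ⟨hk, hu⟩ := List.append_inj h4 hlen
    have hkey : key = key' := List.ofFn_injective hk
    subst hkey; subst hu
    exact hu'
  · intro hu
    exact ⟨x, ρ, t, pad, key, u, rfl, hu⟩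

/-! ### The keyed run of `F` and the MEAN estimator -/

/-- **The keyed-run parameters of the node tests**: the oracle algorithm `F`, the input length `nOf L` read off the
layout length, and `|key| = 6(2T(n) + n + anc(n) + 1)²` key wires. [cite: Zhandry2012IBE, Thm. 3.1] -/
def keyedRun (nOf : ℕ → ℕ) (h : ∀ L, nOf L ≤ L) : KeyedRun where
  F := F
  nOf := nOf
  κOf := fun L => keyPoly.eval (kOf F (nOf L) + mOf F (nOf L))
  nOf_le := h

/-- **The layout of an instance**: the input `x` of `F`, then the parameter string carrying the whole instance
`⟨x, ⟨encPath ρ, t⟩⟩` and the padding. [cite: AaronsonAmbainis2014, Thm. 23 (proof, p. 14)] -/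
def layout (x : List Bool) (ρ : List (Fin (numOracleBits F x) × Bool)) (t pad : List Bool) : List Bool :=
  x ++ paramStr (boolPair x (boolPair (encPath F x ρ) t)) pad

/-- **The measured string of `F` read through the transported wires** of the keyed family on the instance `z`.
[cite: BennettBernsteinBrassardVazirani1997, §4 (the subroutine's wires)] -/
def readRun (P : KeyedRun) (z s : List Bool) : List Bool :=
  List.ofFn fun i : Fin (P.nOf z.length + P.mF z.length) => s.getD ((P.emb z.length i : Fin (z.length + P.anc z.length)) : ℕ) false

variable {F}
set_option maxHeartbeats 400000 in
/-- **The keyed family estimates the key-average of any run statistic of `F` on the overridden hash.** For an instance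
laid out as `z = layout F x ρ t pad` with `nOf |z| = |x|` and an event `E` on the measured string of `F` (read through
the transported wires): the keyed family relative to `A' = keyedLang F` shows `E` with probability
`2^{-|key|} Σ_key F.kernelProb (oracleOf F x (hashedPt F x ρ key)) x E`.
[cite: Zhandry2012IBE, Thm. 3.1] [cite: BennettBernsteinBrassardVazirani1997, §4] -/
theorem kernelProb_keyedRun_event_eq_avg (nOf : ℕ → ℕ) (h : ∀ L, nOf L ≤ L) (x : List Bool)
    (ρ : List (Fin (numOracleBits F x) × Bool)) (t pad : List Bool) (hx : nOf (layout F x ρ t pad).length = x.length)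
    (E : Set (List Bool)) [DecidablePred (· ∈ E)] :
    (keyedRun F nOf h).family.kernelProb (keyedLang F) (layout F x ρ t pad)
        {s | readRun (keyedRun F nOf h) (layout F x ρ t pad) s ∈ E} =
      (∑ key : Fin (keyPoly.eval (kOf F x.length + mOf F x.length)) → Bool,
        F.kernelProb (oracleOf F x (hashedPt F x ρ key)) x E) / 2 ^ keyPoly.eval (kOf F x.length + mOf F x.length) := by
  have hmain : (keyedRun F nOf h).family.kernelProb (keyedLang F) (layout F x ρ t pad)
      {s | readRun (keyedRun F nOf h) (layout F x ρ t pad) s ∈ E} =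
      (1 / 2 : ℝ) ^ (keyedRun F nOf h).κOf (layout F x ρ t pad).length *
        ∑ key : QReg ((keyedRun F nOf h).κOf (layout F x ρ t pad).length),
          F.kernelProb (prefixSlice (keyedLang F)
            (paramStr (boolPair x (boolPair (encPath F x ρ) t)) pad ++ List.ofFn key)) x E :=
    (keyedRun F nOf h).kernelProb_family_append_eq_avg (keyedLang F) x _ hx E
  rw [hmain]
  change (1 / 2 : ℝ) ^ keyPoly.eval (kOf F (nOf (layout F x ρ t pad).length) + mOf F (nOf (layout F x ρ t pad).length)) *
      ∑ key : QReg (keyPoly.eval (kOf F (nOf (layout F x ρ t pad).length) + mOf F (nOf (layout F x ρ t pad).length))),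
        F.kernelProb (prefixSlice (keyedLang F)
          (paramStr (boolPair x (boolPair (encPath F x ρ) t)) pad ++ List.ofFn key)) x E = _
  rw [hx, one_div, inv_pow, inv_mul_eq_div]
  congr 1
  refine Finset.sum_congr rfl fun key _ => ?_
  rw [prefixSlice_keyedLang]

/-- **The MEAN node test is the acceptance probability of the keyed family.** For an instance laid out as
`z = layout F x ρ t pad` with `nOf |z| = |x|`: the probability that the transported answer wire of the keyed family
(oracle `A' = keyedLang F`) reads `1` is EXACTLY `nodeMean F x ρ = E_y[p_x|_ρ(y)]`.
[cite: Zhandry2012IBE, Thm. 3.1] [cite: AaronsonAmbainis2014, Thm. 23 (proof, p. 14)] -/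
theorem kernelProb_keyedRun_accept_eq_nodeMean (nOf : ℕ → ℕ) (h : ∀ L, nOf L ≤ L) (x : List Bool)
    (ρ : List (Fin (numOracleBits F x) × Bool)) (t pad : List Bool) (hx : nOf (layout F x ρ t pad).length = x.length) :
    (keyedRun F nOf h).family.kernelProb (keyedLang F) (layout F x ρ t pad)
        {s | [true] <+: readRun (keyedRun F nOf h) (layout F x ρ t pad) s} = nodeMean F x ρ := by
  classical
  have hev := kernelProb_keyedRun_event_eq_avg nOf h x ρ t pad hx {y | [true] <+: y}
  have hset : {s : List Bool | [true] <+: readRun (keyedRun F nOf h) (layout F x ρ t pad) s} =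
      {s | readRun (keyedRun F nOf h) (layout F x ρ t pad) s ∈ {y : List Bool | [true] <+: y}} := rfl
  rw [hset, hev, nodeMean_eq_hashedAvg F x (kOf F x.length) (mOf F x.length) le_rfl (by rw [mOf_length]; omega) ρ]
  congr 1
  refine Finset.sum_congr rfl fun key _ => ?_
  rw [kernelProb_prefix_true_eq_acceptProbOn]
  rfl

end SimTreePB

end Summit.QuantumAdvantage.QuantumAdvantage.Cruxes.TransferPB.Birth

end
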